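import Mathlib.Analysis.SpecialFunctions.Pow.Real
import Mathlib.Analysis.SpecialFunctions.Log.Basic
import Mathlib.MeasureTheory.Integral.IntervalIntegral.Basic

/-!
# Crux `PerpetualPump.AveragedTypeIBlowup` (stmt-NavierStokesRegularity-1835), line `Sketch`:
# the phase boxes `Pre` / `Pul` of the window one-step theorem imply its tube (lead c1 assembly tools)
-/

noncomputable section
set_option linter.dupNamespace false

open Set MeasureTheory

namespace Summit.NavierStokesRegularity.NavierStokesRegularity.Theorems.PerpetualPumpAveragedTypeIBlowup

/-- **The pre-ignition box implies the tube.** At a pre-ignition time `s ∈ [t₀, t₀+3]` the box `Pre s` of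
`stub_preBoot` (plus `w_n² ≤ b_n/100` and the vanishing of the modes below `n₀`) gives `Tube n s` and
`b_n(s) ≤ B + 3`. [folklore] -/
theorem oneStepCore_tube_of_pre :
    ∀ (ε₀ εb F bhi B : ℝ) (n₀ n : ℤ) (bv wv M0 M1 : ℤ → ℝ → ℝ) (q : ℝ) (R : ℤ → ℝ) (lad : ℕ → ℝ)
      (Tube : ℤ → ℝ → Prop) (t₀ s : ℝ),
      (∀ (m : ℤ) (t : ℝ), Tube m t ↔
        ((∀ k : ℤ, k ≤ m + 1 → |bv k t| ≤ 2 * (bhi + 3) ∧ |wv k t| ≤ 2 * (bhi + 3) ∧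
          M0 k t ≤ 20 * (bhi + 4) ^ 2 ∧ M1 k t ≤ 20 * (bhi + 4) ^ 2) ∧
        (∀ j : ℕ, 2 ≤ j → |bv (m + j) t| ≤ lad j ∧ |wv (m + j) t| ≤ lad j ∧
          M0 (m + j) t ≤ lad j ∧ M1 (m + j) t ≤ lad j))) →
      0 < εb → εb ≤ 1 → 0 ≤ F → F * εb * B ≤ 1 → εb * (bhi + 4) ^ 2 ≤ 1 → 1 ≤ q → q ≤ 21 / 20 →
      10 ^ 4 ≤ B → B ≤ bhi → (∀ j : ℕ, 0 ≤ lad j) → n₀ ≤ n →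
      (∀ k : ℤ, k < n₀ → bv k s = 0 ∧ wv k s = 0 ∧ M0 k s = 0 ∧ M1 k s = 0) →
      0 ≤ R n * (s - t₀) → R n * (s - t₀) ≤ 3 → (wv n s) ^ 2 ≤ bv n s / 100 →
        ((B * Real.exp (-(R n * (s - t₀))) - 3 / 2 ≤ bv n s ∧ bv n s ≤ B * Real.exp (-(R n * (s - t₀))) + 5 / 2 ∧
          0 ≤ wv n s ∧ M0 n s ≤ 6 * (B + 3) ∧
          M1 n s ≤ F * εb * B + 2 * wv n s + 2 * εb * (B + 3) ^ 2 * (R n * (s - t₀))) ∧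
        (n₀ ≤ n - 1 → -(1 / 100) ≤ wv (n - 1) s ∧ (wv (n - 1) s) ^ 2 ≤ q ^ 3 * B + 2 ∧
          -(2 / 5) ≤ bv (n - 1) s ∧ bv (n - 1) s ≤ 17 / 20 ∧
          (t₀ + 2 * (100 + 4 * Real.log (bhi + 5)) / (B * R n) ≤ s → |wv (n - 1) s| ≤ 1 / 200 ∧ bv (n - 1) s ≤ 3 / 10) ∧
          M0 (n - 1) s ≤ 6 * (bhi + 4) ^ 2 ∧ M1 (n - 1) s ≤ 6 * (bhi + 4) ^ 2 ∧
          (1 + ε₀) ^ (-(2 : ℤ)) * R n * ∫ u in t₀..s, (wv (n - 1) u) ^ 2 ≤ 9 / 10) ∧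
        (|bv (n + 1) s| ≤ εb + q / 100 + 1 / 10 ^ 3 ∧ |wv (n + 1) s| ≤ 11 / 10 * εb ∧
          M0 (n + 1) s ≤ εb + (B + 3) / 40 ∧ M1 (n + 1) s ≤ 4 * εb) ∧
        (∀ j : ℕ, 2 ≤ j → |bv (n + j) s| ≤ lad j ∧ |wv (n + j) s| ≤ lad j / 5 ∧
          M0 (n + j) s ≤ lad j ∧ M1 (n + j) s ≤ lad j) ∧
        (∀ k : ℤ, n₀ ≤ k → k ≤ n - 2 → -(9 / 20) ≤ bv k s ∧ bv k s ≤ 7 / 20 ∧ |wv k s| ≤ 1 / 100 ∧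
          M0 k s ≤ 10 * (bhi + 4) ^ 2 + 1 ∧ M1 k s ≤ 10 * (bhi + 4) ^ 2 + 1)) →
      Tube n s ∧ bv n s ≤ B + 3 := by
  intro ε₀ εb F bhi B n₀ n bv wv M0 M1 q R lad Tube t₀ s hTube hεb hεb1 hF hFεB hεbhi hq1 hq2 hB hBhi hlad hn₀
    hvan ht₀s hs3 hpre h
  obtain ⟨⟨hb_lo, hb_hi, hw0, hM0n, hM1n⟩, hprev, ⟨hx1, hy1, hMx1, hMy1⟩, hlad2, htrail⟩ := h
  -- numeric facts of the regime
  have hbhi4 : (1:ℝ) ≤ bhi + 4 := by linarith only [hB, hBhi]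
  have hbhi : (10000:ℝ) ≤ bhi := by norm_num at hB; linarith only [hB, hBhi]
  have hP : bhi + 4 ≤ (bhi + 4) ^ 2 := by nlinarith only [hbhi4]
  have hexp1 : Real.exp (-(R n * (s - t₀))) ≤ 1 := Real.exp_le_one_iff.2 (by linarith only [ht₀s])
  have hexp0 : 0 < Real.exp (-(R n * (s - t₀))) := Real.exp_pos _
  have hB0 : 0 ≤ B := by linarith only [hB]
  have hBe : B * Real.exp (-(R n * (s - t₀))) ≤ B := by nlinarith only [hexp1, hB0, hexp0]
  have hBe0 : 0 ≤ B * Real.exp (-(R n * (s - t₀))) := mul_nonneg hB0 hexp0.le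
  have hbn_hi : bv n s ≤ B + 5 / 2 := by linarith only [hb_hi, hBe]
  have hbn_lo : -(3 / 2) ≤ bv n s := by linarith only [hb_lo, hBe0]
  have hwn : |wv n s| ≤ 2 * (bhi + 3) := by
    refine abs_le_of_sq_le_sq ?_ (by linarith only [hbhi4])
    have : bv n s / 100 ≤ (2 * (bhi + 3)) ^ 2 := by nlinarith only [hbn_hi, hBhi, hbhi4]
    exact hpre.trans this
  have hεB : εb * (B + 3) ^ 2 ≤ 1 := by
    have h1 : (B + 3) ^ 2 ≤ (bhi + 4) ^ 2 := by nlinarith only [hBhi, hB]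
    have h2 : εb * (B + 3) ^ 2 ≤ εb * (bhi + 4) ^ 2 := mul_le_mul_of_nonneg_left h1 hεb.le
    linarith only [h2, hεbhi]
  have hM1n' : M1 n s ≤ 20 * (bhi + 4) ^ 2 := by
    have hw' : wv n s ≤ 2 * (bhi + 3) := (le_abs_self _).trans hwn
    have hst0 : 0 ≤ R n * (s - t₀) := ht₀s
    have hst : εb * (B + 3) ^ 2 * (R n * (s - t₀)) ≤ 3 := by
      have := mul_le_mul hεB hs3 hst0 (by norm_num)
      linarith only [this]
    linarith only [hM1n, hFεB, hw', hst, hP, hbhi4]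
  have hq3 : q ^ 3 ≤ 2 := by
    have := pow_le_pow_left₀ (by linarith only [hq1] : (0:ℝ) ≤ q) hq2 3
    linarith only [this, show ((21:ℝ) / 20) ^ 3 ≤ 2 by norm_num]
  have hqB : q ^ 3 * B + 2 ≤ (2 * (bhi + 3)) ^ 2 := by
    have := mul_le_mul_of_nonneg_right hq3 hB0
    nlinarith only [this, hBhi, hbhi4]
  -- the five kinds of modes
  have hT_trail : ∀ k : ℤ, n₀ ≤ k → k ≤ n - 2 →
      |bv k s| ≤ 2 * (bhi + 3) ∧ |wv k s| ≤ 2 * (bhi + 3) ∧ M0 k s ≤ 20 * (bhi + 4) ^ 2 ∧ M1 k s ≤ 20 * (bhi + 4) ^ 2 := by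
    intro k hk0 hk2
    obtain ⟨h1, h2, h3, h4, h5⟩ := htrail k hk0 hk2
    exact ⟨abs_le.2 ⟨by linarith only [h1, hbhi], by linarith only [h2, hbhi]⟩,
      by linarith only [h3, hbhi], by linarith only [h4, hP, hbhi4], by linarith only [h5, hP, hbhi4]⟩
  have hT_prev : n₀ ≤ n - 1 →
      |bv (n - 1) s| ≤ 2 * (bhi + 3) ∧ |wv (n - 1) s| ≤ 2 * (bhi + 3) ∧
        M0 (n - 1) s ≤ 20 * (bhi + 4) ^ 2 ∧ M1 (n - 1) s ≤ 20 * (bhi + 4) ^ 2 := by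
    intro hk0
    obtain ⟨h1, h2, h3, h4, -, h6, h7, -⟩ := hprev hk0
    exact ⟨abs_le.2 ⟨by linarith only [h3, hbhi], by linarith only [h4, hbhi]⟩,
      abs_le_of_sq_le_sq (h2.trans hqB) (by linarith only [hbhi4]),
      by linarith only [h6, hP, hbhi4], by linarith only [h7, hP, hbhi4]⟩
  have hT_front : |bv n s| ≤ 2 * (bhi + 3) ∧ |wv n s| ≤ 2 * (bhi + 3) ∧
      M0 n s ≤ 20 * (bhi + 4) ^ 2 ∧ M1 n s ≤ 20 * (bhi + 4) ^ 2 :=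
    ⟨abs_le.2 ⟨by linarith only [hbn_lo, hbhi], by linarith only [hbn_hi, hBhi, hbhi]⟩, hwn,
      by linarith only [hM0n, hBhi, hP, hbhi4], hM1n'⟩
  have hT_next : |bv (n + 1) s| ≤ 2 * (bhi + 3) ∧ |wv (n + 1) s| ≤ 2 * (bhi + 3) ∧
      M0 (n + 1) s ≤ 20 * (bhi + 4) ^ 2 ∧ M1 (n + 1) s ≤ 20 * (bhi + 4) ^ 2 :=
    ⟨hx1.trans (by linarith only [hεb1, hq2, hbhi]), hy1.trans (by linarith only [hεb1, hbhi]),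
      by linarith only [hMx1, hεb1, hBhi, hP, hbhi4], by linarith only [hMy1, hεb1, hP, hbhi4]⟩
  refine ⟨?_, by linarith only [hbn_hi]⟩
  rw [hTube]
  refine ⟨fun k hk => ?_, fun j hj => ?_⟩
  · rcases lt_or_ge k n₀ with hk0 | hk0
    · obtain ⟨h1, h2, h3, h4⟩ := hvan k hk0
      rw [h1, h2, h3, h4, abs_zero]
      exact ⟨by linarith only [hbhi], by linarith only [hbhi], by positivity, by positivity⟩
    · have hcases : k ≤ n - 2 ∨ k = n - 1 ∨ k = n ∨ k = n + 1 := by omega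
      rcases hcases with hk2 | hk1 | hk1 | hk1
      · exact hT_trail k hk0 hk2
      · rw [hk1] at hk0 ⊢; exact hT_prev hk0
      · rw [hk1]; exact hT_front
      · rw [hk1]; exact hT_next
  · obtain ⟨h1, h2, h3, h4⟩ := hlad2 j hj
    exact ⟨h1, h2.trans (by linarith only [hlad j]), h3, h4⟩

/-- **The pulse box implies the tube.** At a pulse time `s` the box `Pul s` of `stub_pulseBoot` (ignition
level `0 ≤ b_n(tι) ≤ B + 5/2`, vanishing below `n₀`) gives `Tube n s` and `b_n(s) ≤ B + 3`. [folklore] -/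
theorem oneStepCore_tube_of_pul :
    ∀ (ε₀ εb F bhi B : ℝ) (n₀ n : ℤ) (bv wv M0 M1 : ℤ → ℝ → ℝ) (q : ℝ) (R : ℤ → ℝ) (lad : ℕ → ℝ)
      (Tube : ℤ → ℝ → Prop) (t₀ s tι : ℝ),
      (∀ (m : ℤ) (t : ℝ), Tube m t ↔
        ((∀ k : ℤ, k ≤ m + 1 → |bv k t| ≤ 2 * (bhi + 3) ∧ |wv k t| ≤ 2 * (bhi + 3) ∧
          M0 k t ≤ 20 * (bhi + 4) ^ 2 ∧ M1 k t ≤ 20 * (bhi + 4) ^ 2) ∧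
        (∀ j : ℕ, 2 ≤ j → |bv (m + j) t| ≤ lad j ∧ |wv (m + j) t| ≤ lad j ∧
          M0 (m + j) t ≤ lad j ∧ M1 (m + j) t ≤ lad j))) →
      0 < εb → εb ≤ 1 → 0 ≤ F → F * εb * B ≤ 1 → εb * (bhi + 4) ^ 2 ≤ 1 → 1 ≤ q → q ≤ 21 / 20 →
      10 ^ 4 ≤ B → B ≤ bhi → (∀ j : ℕ, 0 ≤ lad j) → n₀ ≤ n →
      (∀ k : ℤ, k < n₀ → bv k s = 0 ∧ wv k s = 0 ∧ M0 k s = 0 ∧ M1 k s = 0) →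
      0 ≤ bv n tι → bv n tι ≤ B + 5 / 2 →
        ((-(1 / 2) ≤ bv n s ∧ bv n s ≤ bv n tι + 1 / 100 ∧ |wv n s| ≤ bv n tι + 1 / 100 ∧
          -(q / 50) ≤ bv (n + 1) s ∧ bv (n + 1) s ≤ q * (bv n tι + 1 / 100) ∧
          M0 n s ≤ 3 * (bhi + 4) ^ 2 ∧ M1 n s ≤ 5 * (bhi + 4) ^ 2 ∧ M0 (n + 1) s ≤ 3 / 2 * B ∧
          |wv (n + 1) s| ≤ 1 / 10 ^ 3 ∧ M1 (n + 1) s ≤ 1) ∧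
        (n₀ ≤ n - 1 → |wv (n - 1) s| ≤ 1 / 200 ∧ -(2 / 5) ≤ bv (n - 1) s ∧ bv (n - 1) s ≤ 3 / 10 ∧
          M0 (n - 1) s ≤ 6 * (bhi + 4) ^ 2 ∧ M1 (n - 1) s ≤ 6 * (bhi + 4) ^ 2 ∧
          (1 + ε₀) ^ (-(2 : ℤ)) * R n * ∫ u in t₀..s, (wv (n - 1) u) ^ 2 ≤ 9 / 10) ∧
        (∀ j : ℕ, 2 ≤ j → |bv (n + j) s| ≤ lad j ∧ |wv (n + j) s| ≤ lad j / 5 ∧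
          M0 (n + j) s ≤ lad j ∧ M1 (n + j) s ≤ lad j) ∧
        (∀ k : ℤ, n₀ ≤ k → k ≤ n - 2 → -(9 / 20) ≤ bv k s ∧ bv k s ≤ 7 / 20 ∧ |wv k s| ≤ 1 / 100 ∧
          M0 k s ≤ 10 * (bhi + 4) ^ 2 + 1 ∧ M1 k s ≤ 10 * (bhi + 4) ^ 2 + 1)) →
      Tube n s ∧ bv n s ≤ B + 3 := by
  intro ε₀ εb F bhi B n₀ n bv wv M0 M1 q R lad Tube t₀ s tι hTube hεb hεb1 hF hFεB hεbhi hq1 hq2 hB hBhi hlad hn₀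
    hvan hbι0 hbι h
  obtain ⟨⟨hb_lo, hb_hi, hwn, hx_lo, hx_hi, hM0n, hM1n, hM0x, hy1, hMy1⟩, hprev, hlad2, htrail⟩ := h
  have hbhi4 : (1:ℝ) ≤ bhi + 4 := by linarith only [hB, hBhi]
  have hbhi : (10000:ℝ) ≤ bhi := by norm_num at hB; linarith only [hB, hBhi]
  have hP : bhi + 4 ≤ (bhi + 4) ^ 2 := by nlinarith only [hbhi4]
  have hqx : q * (bv n tι + 1 / 100) ≤ 2 * (bhi + 3) := by
    have h1 : bv n tι + 1 / 100 ≤ bhi + 3 := by linarith only [hbι, hBhi]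
    have h2 : q * (bv n tι + 1 / 100) ≤ 21 / 20 * (bhi + 3) := by
      have := mul_le_mul hq2 h1 (by linarith only [hbι0]) (by norm_num)
      linarith only [this]
    linarith only [h2, hbhi]
  have hT_trail : ∀ k : ℤ, n₀ ≤ k → k ≤ n - 2 →
      |bv k s| ≤ 2 * (bhi + 3) ∧ |wv k s| ≤ 2 * (bhi + 3) ∧ M0 k s ≤ 20 * (bhi + 4) ^ 2 ∧ M1 k s ≤ 20 * (bhi + 4) ^ 2 := by
    intro k hk0 hk2
    obtain ⟨h1, h2, h3, h4, h5⟩ := htrail k hk0 hk2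
    exact ⟨abs_le.2 ⟨by linarith only [h1, hbhi], by linarith only [h2, hbhi]⟩,
      by linarith only [h3, hbhi], by linarith only [h4, hP, hbhi4], by linarith only [h5, hP, hbhi4]⟩
  have hT_prev : n₀ ≤ n - 1 →
      |bv (n - 1) s| ≤ 2 * (bhi + 3) ∧ |wv (n - 1) s| ≤ 2 * (bhi + 3) ∧
        M0 (n - 1) s ≤ 20 * (bhi + 4) ^ 2 ∧ M1 (n - 1) s ≤ 20 * (bhi + 4) ^ 2 := by
    intro hk0
    obtain ⟨h1, h2, h3, h4, h5, -⟩ := hprev hk0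
    exact ⟨abs_le.2 ⟨by linarith only [h2, hbhi], by linarith only [h3, hbhi]⟩,
      by linarith only [h1, hbhi], by linarith only [h4, hP, hbhi4], by linarith only [h5, hP, hbhi4]⟩
  have hT_front : |bv n s| ≤ 2 * (bhi + 3) ∧ |wv n s| ≤ 2 * (bhi + 3) ∧
      M0 n s ≤ 20 * (bhi + 4) ^ 2 ∧ M1 n s ≤ 20 * (bhi + 4) ^ 2 :=
    ⟨abs_le.2 ⟨by linarith only [hb_lo, hbhi], by linarith only [hb_hi, hbι, hBhi, hbhi]⟩,
      by linarith only [hwn, hbι, hBhi, hbhi], by linarith only [hM0n, hP, hbhi4], by linarith only [hM1n, hP, hbhi4]⟩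
  have hT_next : |bv (n + 1) s| ≤ 2 * (bhi + 3) ∧ |wv (n + 1) s| ≤ 2 * (bhi + 3) ∧
      M0 (n + 1) s ≤ 20 * (bhi + 4) ^ 2 ∧ M1 (n + 1) s ≤ 20 * (bhi + 4) ^ 2 :=
    ⟨abs_le.2 ⟨by linarith only [hx_lo, hq2, hbhi], by linarith only [hx_hi, hqx]⟩,
      hy1.trans (by linarith only [hbhi]),
      by linarith only [hM0x, hBhi, hP, hbhi4], by linarith only [hMy1, hP, hbhi4]⟩
  refine ⟨?_, by linarith only [hb_hi, hbι]⟩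
  rw [hTube]
  refine ⟨fun k hk => ?_, fun j hj => ?_⟩
  · rcases lt_or_ge k n₀ with hk0 | hk0
    · obtain ⟨h1, h2, h3, h4⟩ := hvan k hk0
      rw [h1, h2, h3, h4, abs_zero]
      exact ⟨by linarith only [hbhi], by linarith only [hbhi], by positivity, by positivity⟩
    · have hcases : k ≤ n - 2 ∨ k = n - 1 ∨ k = n ∨ k = n + 1 := by omega
      rcases hcases with hk2 | hk1 | hk1 | hk1
      · exact hT_trail k hk0 hk2
      · rw [hk1] at hk0 ⊢; exact hT_prev hk0
      · rw [hk1]; exact hT_front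
      · rw [hk1]; exact hT_next
  · obtain ⟨h1, h2, h3, h4⟩ := hlad2 j hj
    exact ⟨h1, h2.trans (by linarith only [hlad j]), h3, h4⟩

end Summit.NavierStokesRegularity.NavierStokesRegularity.Theorems.PerpetualPumpAveragedTypeIBlowup

end
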